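import Mathlib
import Summits.ValiantsHypothesis.ValiantsHypothesis.Theses.ElementaryWordLength
import Literature.Computability.AlgebraicComplexity.NewtonPolygonTauTransfer
import Summits.ValiantsHypothesis.ValiantsHypothesis.Theorems.ElementaryWordLengthWordPerSuperPolyStubWordSubstTerm
import Summits.ValiantsHypothesis.ValiantsHypothesis.Theorems.ElementaryWordLengthWordPerSuperPolyStubTropicalWordBound
import Summits.ValiantsHypothesis.ValiantsHypothesis.Theorems.ElementaryWordLengthWordPerSuperPolyCancellationFormsSlow

/-!
# Crux `WordPerSuperPoly` (stmt-ValiantsHypothesis-6626), line `Sketch` — the line as a CONDITIONAL theorem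

Supports `Summit.ValiantsHypothesis.ValiantsHypothesis.Theses.ElementaryWordLength.WordPerSuperPoly`
(route `ElementaryWordLength`), line `Sketch` (card `newton-shadow-word-tau`, bridge B). The line's
registered skeleton (`Cruxes/WordPerSuperPoly/Lines/Sketch.lean`, v2.3) proves the crux modulo ONE
stub, S2 `stub_cancellationSubexp` — the word Newton-τ statement in its weakest sufficient form,
an OPEN statement (it implies the crux, i.e. `VNP ⊄ VP_e` in word form; it is at least as strong
as the Koiran–Portier–Tavenas–Thomassé Newton-polygon τ-conjecture restricted to bounded-width /
formula computations, KPTT 2015 Conjecture 1 and §5; Chatterjee–Gajjar–Tengse 2023 Conj. 1.3).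
This file lands that composition as honest mathematics: three sorry-free CONDITIONAL theorems,
each taking one form of the word Newton-τ hypothesis INLINE (no new definition, no named fact) and
concluding the crux BY NAME.

* `WordPerSuperPoly_of_cancellationSubexp` (registered signature): the RELATIVE form S2 — for every
  `ε > 0`, cancellation buys at most a factor `A_ε · 2^{L^ε}` in Newton vertices of the `(0,2)`
  entry of a width-3 sparse bivariate word of length `L`, relative to its all-ones companion —
  implies `WordPerSuperPoly`. Uses the landed S1 `stub_tropicalWordBound` (p106377: companions have
  `≤ 6 (L+1)^3` vertices) and T1 `stub_wordSubstTerm` (p104488: words specialise under term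
  substitutions), the tree's bridge B (`TavenasVn.exists_isProjection_hV_perPoly_complex`,
  `KPTT.aeval_xySubst_hV`, `KPTT.newtonVertexCount_kpttPoly`: a term specialisation of `per_{q(n)}`
  with exactly `2^n` Newton vertices) and the analytic core `A · 2^{√(m+2)} · 6 ((m+2)^D + 1)^3 < 2^m`.
* `WordPerSuperPoly_of_newtonWordTauAbsolute`: the ABSOLUTE form — `#vert ≤ A_ε · 2^{L^ε}` for all
  words — implies `WordPerSuperPoly` (S1 not even needed).
* `WordPerSuperPoly_of_newtonWordTauSlow`: the card's SLOW form — `#vert ≤ 2^{2^{K √(log L)}}` for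
  all words of length `≥ 2` — implies `WordPerSuperPoly` (via the landed `absolute_of_slow`, p105548).

What this records for the route: `WordPerSuperPoly` (per has no polynomial-length affine elementary
words, equivalently no polynomial-size formulas) FOLLOWS from any `2^{L^{o(1)}}` upper bound on the
number of Newton-polygon vertices of entries of width-3 sparse bivariate words — the formula/word
analogue of KPTT 2015 Theorem 1 (there: circuits, via depth-4 reduction; here: words, via
Ben-Or–Cleve-free direct specialisation), with the hypothesis in its weakest sufficient shape.
The hypothesis itself is NOT asserted anywhere in the tree.
-/

noncomputable section

-- `Summit.ValiantsHypothesis.ValiantsHypothesis.…` is the tree's mandated single-conjunct layout.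
set_option linter.dupNamespace false

namespace Summit.ValiantsHypothesis.ValiantsHypothesis.Theorems.ElementaryWordLengthWordPerSuperPoly

open MvPolynomial Literature.Computability.AlgebraicComplexity
open Filter Topology

/-- `sparseEntry⟦w⟧` (local notation, not a definition): the `(0,2)` entry of the product of a
sparse bivariate word, letters `(i, j, c, (a, b)) ↦ E_{ij}(c · x^a y^b)`. -/
local notation3 (prettyPrint := false) "sparseEntry⟦" w "⟧" =>
  List.prod (List.map (fun l : Fin 3 × Fin 3 × ℂ × (ℕ × ℕ) =>
    Matrix.transvection l.1 l.2.1
      (MvPolynomial.C l.2.2.1 * (MvPolynomial.X 0 ^ l.2.2.2.1 * MvPolynomial.X 1 ^ l.2.2.2.2) :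
        MvPolynomial (Fin 2) ℂ)) w) 0 2

namespace Conditional

/-- **The witness (bridge B).** There is a p-bounded `q` such that for every `n` some TERM
specialisation of `per_{q(n)}` has a Newton polygon with exactly `2^n` vertices: compose the
projection `h_n = per_{q(n)}(a)` (Valiant's criterion + VNP-completeness of `PER` over `ℂ`,
`TavenasVn.exists_isProjection_hV_perPoly_complex`) with the Kronecker substitution `xySubst`
(`KPTT.aeval_xySubst_hV`: the result is `F_n`, `KPTT.newtonVertexCount_kpttPoly`: `2^n` vertices). -/
theorem perTermWitness :
    ∃ q : ℕ → ℕ, IsPBounded q ∧ ∀ n, ∃ v : Fin (q n) × Fin (q n) → MvPolynomial (Fin 2) ℂ,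
      (∀ s, IsMvTerm (v s)) ∧ newtonVertexCount (aeval v (perPoly (Fin (q n)) ℂ)) = 2 ^ n := by
  obtain ⟨q, hq, hproj⟩ := TavenasVn.exists_isProjection_hV_perPoly_complex
  refine ⟨q, hq, fun n => ?_⟩
  obtain ⟨a, ha, hEq⟩ := hproj n
  refine ⟨fun s => aeval (xySubst (TavenasVn.R n) (TavenasVn.R n)) (a s), fun s => ?_, ?_⟩
  · show IsMvTerm (aeval (xySubst (TavenasVn.R n) (TavenasVn.R n)) (a s))
    rcases ha s with ⟨j, hj⟩ | ⟨c, hc⟩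
    · rw [hj, aeval_X]; exact isMvTerm_xySubst _ _ j
    · rw [hc, aeval_C, algebraMap_eq]; exact isMvTerm_C c
  · rw [← comp_aeval_apply, ← hEq, KPTT.aeval_xySubst_hV, KPTT.newtonVertexCount_kpttPoly]

/-- Analytic core of the composition: with `x = m + 2` and `ε = 1/(2D)`,
`A · 2^{(x^D)^ε} · 6 (x^D + 1)^3 < 2^m` for all large `m` (`(x^D)^ε = √x ≤ x/4 + 1`, and a
polynomial is eventually below `2^{3x/4}`). -/
theorem eventually_subexp_lt_two_pow (D : ℕ) (hD : 1 ≤ D) (A : ℝ) (hA : 0 ≤ A) :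
    ∃ M : ℕ, ∀ m : ℕ, M ≤ m →
      A * (2 : ℝ) ^ ((((m : ℝ) + 2) ^ D) ^ (1 / (2 * (D : ℝ)))) *
        (6 * (((m : ℝ) + 2) ^ D + 1) ^ 3) < (2 : ℝ) ^ m := by
  -- the exponential rate `r = 2^{3/4} > 1` and the polynomial/exponential limit
  set r : ℝ := (2 : ℝ) ^ (3 / 4 : ℝ) with hr_def
  have hr1 : 1 < r := Real.one_lt_rpow (by norm_num) (by norm_num)
  have hrpos : 0 < r := lt_trans one_pos hr1
  have hlim := tendsto_pow_const_div_const_pow_of_one_lt (3 * D) hr1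
  -- constant `K`: we need `K · m^{3D} < r^m` eventually
  set K : ℝ := 800 * (A + 1) * (3 : ℝ) ^ (3 * D) with hK_def
  have hKpos : 0 < K := by positivity
  have hev : ∀ᶠ m : ℕ in atTop, (m : ℝ) ^ (3 * D) / r ^ m < 1 / K :=
    hlim.eventually (gt_mem_nhds (by positivity))
  obtain ⟨M₀, hM₀⟩ := Filter.eventually_atTop.1 hev
  refine ⟨max M₀ 1, fun m hm => ?_⟩
  have hmM₀ : M₀ ≤ m := le_trans (le_max_left _ _) hm
  have hm1 : 1 ≤ m := le_trans (le_max_right _ _) hm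
  have hm1r : (1 : ℝ) ≤ m := by exact_mod_cast hm1
  set x : ℝ := (m : ℝ) + 2 with hx_def
  have hx2 : 2 ≤ x := by rw [hx_def]; linarith [(Nat.cast_nonneg m : (0 : ℝ) ≤ m)]
  have hxpos : 0 < x := by linarith
  have hx0 : 0 ≤ x := hxpos.le
  have hx1 : 1 ≤ x := by linarith
  -- (1) `(x^D)^{1/(2D)} = √x ≤ x/4 + 1`
  have hroot : (x ^ D) ^ (1 / (2 * (D : ℝ))) = Real.sqrt x := by
    rw [← Real.rpow_natCast x D, ← Real.rpow_mul hx0, Real.sqrt_eq_rpow]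
    congr 1
    have hD0 : (D : ℝ) ≠ 0 := by exact_mod_cast (show D ≠ 0 by omega)
    field_simp
  have hsqrt : Real.sqrt x ≤ x / 4 + 1 := by
    rw [Real.sqrt_le_left (by positivity)]
    nlinarith [sq_nonneg (x / 4 - 1)]
  have hexp1 : (2 : ℝ) ^ ((x ^ D) ^ (1 / (2 * (D : ℝ)))) ≤ 2 * (2 : ℝ) ^ (x / 4) := by
    rw [hroot]
    calc (2 : ℝ) ^ (Real.sqrt x) ≤ (2 : ℝ) ^ (x / 4 + 1) :=
          Real.rpow_le_rpow_of_exponent_le (by norm_num) hsqrt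
      _ = 2 * (2 : ℝ) ^ (x / 4) := by
          rw [Real.rpow_add (by norm_num : (0 : ℝ) < 2), Real.rpow_one]; ring
  -- (2) the polynomial factor: `6 (x^D + 1)^3 ≤ 48 x^{3D} ≤ 48 · 3^{3D} m^{3D}`
  have hxD1 : 1 ≤ x ^ D := one_le_pow₀ hx1
  have hpoly : 6 * (x ^ D + 1) ^ 3 ≤ 48 * (3 : ℝ) ^ (3 * D) * (m : ℝ) ^ (3 * D) := by
    have h1 : (x ^ D + 1) ^ 3 ≤ (2 * x ^ D) ^ 3 :=
      pow_le_pow_left₀ (by positivity) (by linarith) 3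
    have h2 : (2 * x ^ D) ^ 3 = 8 * x ^ (3 * D) := by ring
    have hx3 : x ≤ 3 * m := by rw [hx_def]; linarith
    have h3 : x ^ (3 * D) ≤ (3 * (m : ℝ)) ^ (3 * D) := pow_le_pow_left₀ hx0 hx3 _
    have h4 : (3 * (m : ℝ)) ^ (3 * D) = (3 : ℝ) ^ (3 * D) * (m : ℝ) ^ (3 * D) := mul_pow _ _ _
    nlinarith [h1, h2, h3, h4, pow_nonneg hx0 (3 * D)]
  -- (3) the limit: `K m^{3D} < r^m`
  have hKm : K * (m : ℝ) ^ (3 * D) < r ^ m := by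
    have h := hM₀ m hmM₀
    have hrm : 0 < r ^ m := pow_pos hrpos m
    rw [div_lt_div_iff₀ hrm hKpos] at h
    linarith
  -- (4) `2^m = 2^{x/4} · 2^{3x/4 - 2}` and `r^m = 2^{3x/4} · 2^{-3/2}`
  have h2m : (2 : ℝ) ^ (m : ℕ) = (2 : ℝ) ^ (x / 4) * ((2 : ℝ) ^ (3 * x / 4) / 4) := by
    have : ((2 : ℝ) ^ (3 * x / 4) / 4) = (2 : ℝ) ^ (3 * x / 4 - 2) := by
      rw [Real.rpow_sub (by norm_num : (0 : ℝ) < 2)]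
      norm_num
    rw [this, ← Real.rpow_add (by norm_num : (0 : ℝ) < 2), ← Real.rpow_natCast]
    congr 1
    rw [hx_def]; ring
  have hrm_eq : r ^ m = (2 : ℝ) ^ (3 * x / 4) * (2 : ℝ) ^ (-(3 / 2 : ℝ)) := by
    rw [hr_def, ← Real.rpow_natCast, ← Real.rpow_mul (by norm_num : (0 : ℝ) ≤ 2),
      ← Real.rpow_add (by norm_num : (0 : ℝ) < 2)]
    congr 1
    rw [hx_def]; ring
  have h2neg : (2 : ℝ) ^ (-(3 / 2 : ℝ)) ≤ 1 / 2 := by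
    rw [Real.rpow_neg (by norm_num : (0 : ℝ) ≤ 2)]
    rw [show (1 : ℝ) / 2 = (2 : ℝ)⁻¹ by norm_num]
    apply inv_anti₀ (by norm_num)
    calc (2 : ℝ) = (2 : ℝ) ^ (1 : ℝ) := (Real.rpow_one 2).symm
      _ ≤ (2 : ℝ) ^ (3 / 2 : ℝ) := Real.rpow_le_rpow_of_exponent_le (by norm_num) (by norm_num)
  -- (5) assemble
  have hE : 0 < (2 : ℝ) ^ (x / 4) := Real.rpow_pos_of_pos (by norm_num) _
  have hF : 0 < (2 : ℝ) ^ (3 * x / 4) := Real.rpow_pos_of_pos (by norm_num) _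
  have hmD : 0 ≤ (m : ℝ) ^ (3 * D) := by positivity
  calc A * (2 : ℝ) ^ ((x ^ D) ^ (1 / (2 * (D : ℝ)))) * (6 * (x ^ D + 1) ^ 3)
      ≤ A * (2 * (2 : ℝ) ^ (x / 4)) * (48 * (3 : ℝ) ^ (3 * D) * (m : ℝ) ^ (3 * D)) := by
        gcongr
    _ = (2 : ℝ) ^ (x / 4) * ((96 * A * (3 : ℝ) ^ (3 * D)) * (m : ℝ) ^ (3 * D)) := by ring
    _ ≤ (2 : ℝ) ^ (x / 4) * ((K / 8) * (m : ℝ) ^ (3 * D)) := by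
        gcongr
        rw [hK_def]; nlinarith [pow_nonneg (show (0:ℝ) ≤ 3 by norm_num) (3 * D)]
    _ = (2 : ℝ) ^ (x / 4) * ((K * (m : ℝ) ^ (3 * D)) / 8) := by ring
    _ < (2 : ℝ) ^ (x / 4) * (r ^ m / 8) := by gcongr
    _ = (2 : ℝ) ^ (x / 4) * ((2 : ℝ) ^ (3 * x / 4) * (2 : ℝ) ^ (-(3 / 2 : ℝ)) / 8) := by rw [hrm_eq]
    _ ≤ (2 : ℝ) ^ (x / 4) * ((2 : ℝ) ^ (3 * x / 4) * (1 / 2) / 8) := by gcongr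
    _ ≤ (2 : ℝ) ^ (x / 4) * ((2 : ℝ) ^ (3 * x / 4) / 4) := by
        have hEF := mul_pos hE hF
        nlinarith [hEF]
    _ = (2 : ℝ) ^ (m : ℕ) := h2m.symm

/-- S1 + the relative form S2 give the absolute-with-polynomial form: for every `ε > 0` some
`A ≥ 0` bounds the vertex count of the `(0,2)` entry of any sparse bivariate word of length `L` by
`A · 2^{L^ε} · 6 (L+1)^3`. -/
theorem subexpPoly_of_cancellationSubexp
    (hS2 : ∀ ε : ℝ, 0 < ε → ∃ A : ℝ, ∀ w : List (Fin 3 × Fin 3 × ℂ × (ℕ × ℕ)), (∀ l ∈ w, l.1 ≠ l.2.1) →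
      (newtonVertexCount
        ((w.map (fun l : Fin 3 × Fin 3 × ℂ × (ℕ × ℕ) => Matrix.transvection l.1 l.2.1
          (MvPolynomial.C l.2.2.1 * (MvPolynomial.X 0 ^ l.2.2.2.1 * MvPolynomial.X 1 ^ l.2.2.2.2) :
            MvPolynomial (Fin 2) ℂ))).prod 0 2) : ℝ) ≤
        A * (2 : ℝ) ^ ((w.length : ℝ) ^ ε) *
          (newtonVertexCount
            (((w.map (fun l => (l.1, l.2.1, (1 : ℂ), l.2.2.2))).map
              (fun l : Fin 3 × Fin 3 × ℂ × (ℕ × ℕ) => Matrix.transvection l.1 l.2.1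
                (MvPolynomial.C l.2.2.1 * (MvPolynomial.X 0 ^ l.2.2.2.1 * MvPolynomial.X 1 ^ l.2.2.2.2) :
                  MvPolynomial (Fin 2) ℂ))).prod 0 2) : ℝ)) :
    ∀ ε : ℝ, 0 < ε → ∃ A : ℝ, 0 ≤ A ∧ ∀ w : List (Fin 3 × Fin 3 × ℂ × (ℕ × ℕ)),
      (∀ l ∈ w, l.1 ≠ l.2.1) →
      (newtonVertexCount (sparseEntry⟦w⟧) : ℝ) ≤
        A * (2 : ℝ) ^ ((w.length : ℝ) ^ ε) * (6 * ((w.length : ℝ) + 1) ^ 3) := by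
  intro ε hε
  obtain ⟨A, hA⟩ := hS2 ε hε
  refine ⟨max A 0, le_max_right _ _, fun w hw => ?_⟩
  have h1 := hA w hw
  set w1 : List (Fin 3 × Fin 3 × ℂ × (ℕ × ℕ)) := w.map (fun l => (l.1, l.2.1, (1 : ℂ), l.2.2.2))
    with hw1
  have hw1ne : ∀ l ∈ w1, l.1 ≠ l.2.1 := by
    intro l hl
    obtain ⟨l', hl', rfl⟩ := List.mem_map.1 hl
    exact hw l' hl'
  have hw1pos : ∀ l ∈ w1, ∃ r : ℝ, 0 < r ∧ l.2.2.1 = (r : ℂ) := by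
    intro l hl
    obtain ⟨l', _, rfl⟩ := List.mem_map.1 hl
    exact ⟨1, one_pos, by simp⟩
  have h2 := stub_tropicalWordBound w1 hw1ne hw1pos
  have hlen : w1.length = w.length := by simp [hw1]
  rw [hlen] at h2
  have h2' : (newtonVertexCount (sparseEntry⟦w1⟧) : ℝ) ≤ 6 * ((w.length : ℝ) + 1) ^ 3 := by
    exact_mod_cast h2
  have hpow : (0 : ℝ) ≤ (2 : ℝ) ^ ((w.length : ℝ) ^ ε) := by positivity
  have hV0 : (0 : ℝ) ≤ (newtonVertexCount (sparseEntry⟦w1⟧) : ℝ) := by positivity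
  calc (newtonVertexCount (sparseEntry⟦w⟧) : ℝ)
      ≤ A * (2 : ℝ) ^ ((w.length : ℝ) ^ ε) * (newtonVertexCount (sparseEntry⟦w1⟧) : ℝ) := h1
    _ ≤ max A 0 * (2 : ℝ) ^ ((w.length : ℝ) ^ ε) * (newtonVertexCount (sparseEntry⟦w1⟧) : ℝ) :=
        mul_le_mul_of_nonneg_right (mul_le_mul_of_nonneg_right (le_max_left _ _) hpow) hV0
    _ ≤ max A 0 * (2 : ℝ) ^ ((w.length : ℝ) ^ ε) * (6 * ((w.length : ℝ) + 1) ^ 3) :=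
        mul_le_mul_of_nonneg_left h2' (mul_nonneg (le_max_right _ _) hpow)

/-- The absolute form gives the absolute-with-polynomial form trivially (`6 (L+1)^3 ≥ 1`). -/
theorem subexpPoly_of_absolute
    (habs : ∀ ε : ℝ, 0 < ε → ∃ A : ℝ, ∀ w : List (Fin 3 × Fin 3 × ℂ × (ℕ × ℕ)), (∀ l ∈ w, l.1 ≠ l.2.1) →
      (newtonVertexCount
        ((w.map (fun l : Fin 3 × Fin 3 × ℂ × (ℕ × ℕ) => Matrix.transvection l.1 l.2.1
          (MvPolynomial.C l.2.2.1 * (MvPolynomial.X 0 ^ l.2.2.2.1 * MvPolynomial.X 1 ^ l.2.2.2.2) :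
            MvPolynomial (Fin 2) ℂ))).prod 0 2) : ℝ) ≤ A * (2 : ℝ) ^ ((w.length : ℝ) ^ ε)) :
    ∀ ε : ℝ, 0 < ε → ∃ A : ℝ, 0 ≤ A ∧ ∀ w : List (Fin 3 × Fin 3 × ℂ × (ℕ × ℕ)),
      (∀ l ∈ w, l.1 ≠ l.2.1) →
      (newtonVertexCount (sparseEntry⟦w⟧) : ℝ) ≤
        A * (2 : ℝ) ^ ((w.length : ℝ) ^ ε) * (6 * ((w.length : ℝ) + 1) ^ 3) := by
  intro ε hε
  obtain ⟨A, hA⟩ := habs ε hε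
  refine ⟨max A 0, le_max_right _ _, fun w hw => ?_⟩
  have hpow : (0 : ℝ) ≤ (2 : ℝ) ^ ((w.length : ℝ) ^ ε) := by positivity
  have hpoly : (1 : ℝ) ≤ 6 * ((w.length : ℝ) + 1) ^ 3 := by
    have : (1 : ℝ) ≤ ((w.length : ℝ) + 1) ^ 3 := one_le_pow₀ (by linarith [(Nat.cast_nonneg w.length : (0 : ℝ) ≤ w.length)])
    linarith
  have hA0 : 0 ≤ max A 0 * (2 : ℝ) ^ ((w.length : ℝ) ^ ε) := mul_nonneg (le_max_right _ _) hpow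
  calc (newtonVertexCount (sparseEntry⟦w⟧) : ℝ) ≤ A * (2 : ℝ) ^ ((w.length : ℝ) ^ ε) := hA w hw
    _ ≤ max A 0 * (2 : ℝ) ^ ((w.length : ℝ) ^ ε) := mul_le_mul_of_nonneg_right (le_max_left _ _) hpow
    _ = max A 0 * (2 : ℝ) ^ ((w.length : ℝ) ^ ε) * 1 := (mul_one _).symm
    _ ≤ max A 0 * (2 : ℝ) ^ ((w.length : ℝ) ^ ε) * (6 * ((w.length : ℝ) + 1) ^ 3) :=
        mul_le_mul_of_nonneg_left hpoly hA0

/-- **The composition.** The absolute-with-polynomial form of the word Newton-τ bound implies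
`WordPerSuperPoly` BY NAME. Given `k`, let `q` be the p-bounded size of bridge B, `q m ≤ (m+2)^e`,
`D = e k + k + 1`, `ε = 1/(2D)`, `A` from the hypothesis, and `m` beyond the threshold of the
analytic core; put `n = q m`. A word of length `≤ n^k + k ≤ (m+2)^D` for `E_13(per_n)` specialises
(T1) to a sparse word for `F_m` of no greater length, whose Newton polygon has `2^m` vertices but at
most `A · 2^{((m+2)^D)^ε} · 6 ((m+2)^D + 1)^3 < 2^m`. -/
theorem WordPerSuperPoly_of_subexpPoly
    (hsub : ∀ ε : ℝ, 0 < ε → ∃ A : ℝ, 0 ≤ A ∧ ∀ w : List (Fin 3 × Fin 3 × ℂ × (ℕ × ℕ)),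
      (∀ l ∈ w, l.1 ≠ l.2.1) →
      (newtonVertexCount (sparseEntry⟦w⟧) : ℝ) ≤
        A * (2 : ℝ) ^ ((w.length : ℝ) ^ ε) * (6 * ((w.length : ℝ) + 1) ^ 3)) :
    Summit.ValiantsHypothesis.ValiantsHypothesis.Theses.ElementaryWordLength.WordPerSuperPoly := by
  intro k
  obtain ⟨q, hq, hwit⟩ := perTermWitness
  obtain ⟨e, he⟩ := hq.exists_le_pow
  set D : ℕ := e * k + k + 1 with hD_def
  have hD1 : 1 ≤ D := by omega
  have hε : (0 : ℝ) < 1 / (2 * (D : ℝ)) := by positivity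
  obtain ⟨A, hA0, hA⟩ := hsub (1 / (2 * (D : ℝ))) hε
  obtain ⟨M, hM⟩ := eventually_subexp_lt_two_pow D hD1 A hA0
  -- the bad size `n = q M`
  refine ⟨q M, ?_⟩
  rintro ⟨w, hlen, hne, hprod⟩
  obtain ⟨v, hv, hcount⟩ := hwit M
  obtain ⟨w', hlen', hne', hentry⟩ := stub_wordSubstTerm (perPoly (Fin (q M)) ℂ) v hv w hne hprod
  -- length bookkeeping: `w'.length ≤ (q M)^k + k ≤ (M+2)^D`
  have hB2 : 2 ≤ M + 2 := by omega
  have hqM : q M ≤ (M + 2) ^ e := he M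
  have hL : w'.length ≤ (M + 2) ^ D := by
    have h1 : w'.length ≤ (q M) ^ k + k := le_trans hlen' hlen
    have h2 : (q M) ^ k ≤ (M + 2) ^ (e * k) := by
      rw [pow_mul]; exact Nat.pow_le_pow_left hqM k
    have h3 : k + 1 ≤ (M + 2) ^ (k + 1) := by
      calc k + 1 ≤ 2 ^ (k + 1) := Nat.lt_two_pow_self.le
        _ ≤ (M + 2) ^ (k + 1) := Nat.pow_le_pow_left hB2 _
    have h4 : 1 ≤ (M + 2) ^ (e * k) := Nat.one_le_pow _ _ (by omega)
    calc w'.length ≤ (q M) ^ k + k := h1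
      _ ≤ (M + 2) ^ (e * k) + k := Nat.add_le_add_right h2 k
      _ ≤ (M + 2) ^ (e * k) * (k + 1) := by nlinarith
      _ ≤ (M + 2) ^ (e * k) * (M + 2) ^ (k + 1) := Nat.mul_le_mul_left _ h3
      _ = (M + 2) ^ D := by rw [← pow_add, hD_def]; ring_nf
  have hLr : (w'.length : ℝ) ≤ ((M : ℝ) + 2) ^ D := by exact_mod_cast hL
  -- the vertex bound at length `w'.length`, pushed up to `(M+2)^D` by monotonicity
  have hbound := hA w' hne'
  rw [hentry, hcount] at hbound
  have hmono : A * (2 : ℝ) ^ ((w'.length : ℝ) ^ (1 / (2 * (D : ℝ)))) * (6 * ((w'.length : ℝ) + 1) ^ 3) ≤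
      A * (2 : ℝ) ^ ((((M : ℝ) + 2) ^ D) ^ (1 / (2 * (D : ℝ)))) * (6 * (((M : ℝ) + 2) ^ D + 1) ^ 3) := by
    have hL0 : (0 : ℝ) ≤ w'.length := Nat.cast_nonneg _
    have h1 : (w'.length : ℝ) ^ (1 / (2 * (D : ℝ))) ≤ (((M : ℝ) + 2) ^ D) ^ (1 / (2 * (D : ℝ))) :=
      Real.rpow_le_rpow hL0 hLr hε.le
    have h2 : (2 : ℝ) ^ ((w'.length : ℝ) ^ (1 / (2 * (D : ℝ)))) ≤
        (2 : ℝ) ^ ((((M : ℝ) + 2) ^ D) ^ (1 / (2 * (D : ℝ)))) :=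
      Real.rpow_le_rpow_of_exponent_le (by norm_num) h1
    gcongr
  have hlt := hM M le_rfl
  have hfin : ((2 ^ M : ℕ) : ℝ) < (2 : ℝ) ^ M := by
    calc ((2 ^ M : ℕ) : ℝ) ≤ _ := hbound
      _ ≤ _ := hmono
      _ < (2 : ℝ) ^ M := hlt
  have : ((2 ^ M : ℕ) : ℝ) = (2 : ℝ) ^ M := by push_cast; ring
  linarith

end Conditional

open Conditional

/-- **The line `Sketch` as a theorem: the relative word Newton-τ bound implies `WordPerSuperPoly`.**
If for every `ε > 0` there is `A` such that the Newton polygon of the `(0,2)` entry of every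
width-3 sparse bivariate word of length `L` (letters `E_{ij}(c · X^a Y^b)`, `i ≠ j`) has at most
`A · 2^{L^ε}` times as many vertices as that of its all-ones companion (every coefficient replaced by
`1`), then for every `c` there is `n` such that `E_13(per_n)` has no affine elementary word of
length `≤ n^c + c` over `ℂ` — i.e. the permanent has no polynomial-length words (no polynomial-size
formulas, by Ben-Or–Cleve). The hypothesis is the registered open stub S2 `stub_cancellationSubexp`
of the line, verbatim; it is NOT asserted. [conditional on an open hypothesis, stated inline] -/
theorem WordPerSuperPoly_of_cancellationSubexp :
    (∀ ε : ℝ, 0 < ε → ∃ A : ℝ, ∀ w : List (Fin 3 × Fin 3 × ℂ × (ℕ × ℕ)), (∀ l ∈ w, l.1 ≠ l.2.1) →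
      (newtonVertexCount
        ((w.map (fun l : Fin 3 × Fin 3 × ℂ × (ℕ × ℕ) => Matrix.transvection l.1 l.2.1
          (MvPolynomial.C l.2.2.1 * (MvPolynomial.X 0 ^ l.2.2.2.1 * MvPolynomial.X 1 ^ l.2.2.2.2) :
            MvPolynomial (Fin 2) ℂ))).prod 0 2) : ℝ) ≤
        A * (2 : ℝ) ^ ((w.length : ℝ) ^ ε) *
          (newtonVertexCount
            (((w.map (fun l => (l.1, l.2.1, (1 : ℂ), l.2.2.2))).map
              (fun l : Fin 3 × Fin 3 × ℂ × (ℕ × ℕ) => Matrix.transvection l.1 l.2.1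
                (MvPolynomial.C l.2.2.1 * (MvPolynomial.X 0 ^ l.2.2.2.1 * MvPolynomial.X 1 ^ l.2.2.2.2) :
                  MvPolynomial (Fin 2) ℂ))).prod 0 2) : ℝ)) →
    Summit.ValiantsHypothesis.ValiantsHypothesis.Theses.ElementaryWordLength.WordPerSuperPoly :=
  fun hS2 => WordPerSuperPoly_of_subexpPoly (subexpPoly_of_cancellationSubexp hS2)

/-- **The absolute word Newton-τ bound implies `WordPerSuperPoly`.** If for every `ε > 0` there is
`A` with `#vert Newt((0,2) entry) ≤ A · 2^{L^ε}` for every width-3 sparse bivariate word of length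
`L`, then the permanent has no polynomial-length affine elementary words over `ℂ`.
[conditional on an open hypothesis, stated inline] -/
theorem WordPerSuperPoly_of_newtonWordTauAbsolute :
    (∀ ε : ℝ, 0 < ε → ∃ A : ℝ, ∀ w : List (Fin 3 × Fin 3 × ℂ × (ℕ × ℕ)), (∀ l ∈ w, l.1 ≠ l.2.1) →
      (newtonVertexCount
        ((w.map (fun l : Fin 3 × Fin 3 × ℂ × (ℕ × ℕ) => Matrix.transvection l.1 l.2.1
          (MvPolynomial.C l.2.2.1 * (MvPolynomial.X 0 ^ l.2.2.2.1 * MvPolynomial.X 1 ^ l.2.2.2.2) :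
            MvPolynomial (Fin 2) ℂ))).prod 0 2) : ℝ) ≤ A * (2 : ℝ) ^ ((w.length : ℝ) ^ ε)) →
    Summit.ValiantsHypothesis.ValiantsHypothesis.Theses.ElementaryWordLength.WordPerSuperPoly :=
  fun habs => WordPerSuperPoly_of_subexpPoly (subexpPoly_of_absolute habs)

/-- **The slow word Newton-τ bound implies `WordPerSuperPoly`.** If some `K` bounds the number of
Newton vertices of the `(0,2)` entry of every width-3 sparse bivariate word of length `L ≥ 2` by
`2^{2^{K √(log L)}}` (the card's `NewtonWordTauSlow`; a bound that the determinant's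
`n^{O(log n)}`-length words survive for every value of the Birkhoff shadow complexity up to
`2^{O(n)}`), then the permanent has no polynomial-length affine elementary words over `ℂ`
(via the landed `absolute_of_slow`). [conditional on an open hypothesis, stated inline] -/
theorem WordPerSuperPoly_of_newtonWordTauSlow :
    (∃ K : ℝ, ∀ w : List (Fin 3 × Fin 3 × ℂ × (ℕ × ℕ)), (∀ l ∈ w, l.1 ≠ l.2.1) →
      2 ≤ w.length →
      (newtonVertexCount ((w.map
          (fun l : Fin 3 × Fin 3 × ℂ × (ℕ × ℕ) => Matrix.transvection l.1 l.2.1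
            (MvPolynomial.C l.2.2.1 * (MvPolynomial.X 0 ^ l.2.2.2.1 * MvPolynomial.X 1 ^ l.2.2.2.2) :
              MvPolynomial (Fin 2) ℂ))).prod 0 2) : ℝ) ≤
        (2 : ℝ) ^ ((2 : ℝ) ^ (K * Real.sqrt (Real.log (w.length : ℝ))))) →
    Summit.ValiantsHypothesis.ValiantsHypothesis.Theses.ElementaryWordLength.WordPerSuperPoly :=
  fun hslow => WordPerSuperPoly_of_newtonWordTauAbsolute (absolute_of_slow hslow)

end Summit.ValiantsHypothesis.ValiantsHypothesis.Theorems.ElementaryWordLengthWordPerSuperPoly
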